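import Summits.HodgeConjecture.HodgeConjecture.Theorems.SignSymmetricPowersNodalFormPairHessian

/-!
# K1-B nodal forms (route `SignSymmetricPowers`, item stmt-HodgeConjecture-19716) — the exchanged pair, II

Helper file for the registered stub `stub_signNodalForms` (third conjunct), continuing
`SignSymmetricPowersNodalFormPairHessian.lean`: for the pair-witness
`f = (x₀² - x₂²)² (x₀^{2n} + x₂^{2n}) + x₂^{2n+2} (x₁² + x₃x₄) + c₁ x₁^{2n+4} + x₃^{2n+4} + c₄ x₄^{2n+4}`
with the transversal coefficients `c₁ = 2 / ((2n+4) ρ₁^{n+1})`, `c₄ = 1 / ((2n+4)² ρ₂^{2n+2})`,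
`ρ₂ = 50(4ⁿ + 1) + 1`, `ρ₁ = 2ρ₂`, the ONLY singular points are `[p₊], [p₋]`; homogeneity, ι-evenness and
the third conjunct of the stub (`exists_pairNodalForm`). Landed `--supports stmt-HodgeConjecture-19716` as a
helper. Sorry-free; axioms standard. Uniqueness (blueprint `memos/K1B-NODAL-FORMS-g22.md` §(pair), with a
split transversal part): write `a = z₀`, `b = z₂`, `φ = a² - b²`, `g = a^{2n} + b^{2n}`, `Q = z₁² + z₃z₄`, and let `∇f(z) = 0`.
* `b = 0` forces `z = 0` (`∂₁, ∂₃, ∂₄` kill `z₁, z₃, z₄`; then `a·∂₀f + b·∂₂f` kills `a`).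
* `b ≠ 0`. Transversal dichotomies from `∂₁f, ∂₃f, ∂₄f` and the choice of `c₁, c₄`: `z₁ = 0` or
  `|z₁²| = ρ₁|b|²`; `z₃ = z₄ = 0` or `|z₃z₄| = ρ₂|b|²` (norms of `(z₁²)^{n+1} = -(ρ₁b²)^{n+1}`,
  `(z₃z₄)^{2n+2} = (ρ₂b²)^{2n+2}`). Base identities: `a∂₀f = φ·B(a,b)` with
  `B = (2n+4)a^{2n+2} - 2n a^{2n}b² + 4a²b^{2n}`, and Euler `a∂₀f + b∂₂f = (2n+4)φ²g + (2n+2)b^{2n+2}Q`.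
  - `Q = 0`: then `φ²g = 0`, hence `φ = 0` (`g = 0` would give `n b^{2n} φ² = 0` from `b∂₂f`, impossible),
    i.e. `a = ±b`; and `z₁ = z₃ = z₄ = 0` (else `|z₁²| = |z₃z₄|`, `ρ₁ = ρ₂`): `z = b • p±`.
  - `Q ≠ 0`: then `φ ≠ 0`, so `B(a,b) = 0`, forcing `|a| ≤ 2|b|` (`norm_le_two_mul_norm`); hence
    `|φ²g| ≤ 25(4ⁿ+1)|b|^{2n+4}` (`norm_base_le`), by Euler `|Q| ≤ 50(4ⁿ+1)|b|²`, while the dichotomies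
    give `|Q| ≥ ρ₂|b|²`, `ρ₂ > 50(4ⁿ+1)` — contradiction.
-/

set_option linter.dupNamespace false

noncomputable section

namespace Summit.HodgeConjecture.HodgeConjecture.Theorems.SignSymmetricPowersNodalFormPair

open MvPolynomial Literature.AlgebraicGeometry.Motives Literature.AlgebraicGeometry.HodgeTheory
open Summit.HodgeConjecture.HodgeConjecture.Theorems.SignSymmetricPowersNodalFormsTools
open Summit.HodgeConjecture.HodgeConjecture.Theorems.SignSymmetricPowersNodalFormPairHessian

/-! ## Three lemmas on complex norms -/
/-- Equal (or opposite) powers have equal norms. -/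
theorem norm_eq_norm_of_pow_eq {x y : ℂ} {k : ℕ} (hk : k ≠ 0) (h : x ^ k = y ^ k ∨ x ^ k = -(y ^ k)) :
    ‖x‖ = ‖y‖ := by
  have h' : ‖x‖ ^ k = ‖y‖ ^ k := by
    rcases h with h | h
    · simpa [norm_pow] using congrArg norm h
    · simpa [norm_pow, norm_neg] using congrArg norm h
  exact (pow_left_inj₀ (norm_nonneg _) (norm_nonneg _) hk).1 h'

/-- **The base critical equation bounds `a` by `b`**: if `B(a,b) = (2n+4)a^{2n+2} - 2n a^{2n} b² + 4a² b^{2n}`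
vanishes and `b ≠ 0` then `|a| ≤ 2|b|` (for `n = 0`, `B = 8a²`; for `n ≥ 1` and `|a| > 2|b|` the first term
dominates the other two). -/
theorem norm_le_two_mul_norm (n : ℕ) {a b : ℂ}
    (hB : (2 * (n : ℂ) + 4) * a ^ (2 * n + 2) - 2 * n * a ^ (2 * n) * b ^ 2 + 4 * a ^ 2 * b ^ (2 * n) = 0) :
    ‖a‖ ≤ 2 * ‖b‖ := by
  rcases Nat.eq_zero_or_pos n with rfl | hn
  · have h8 : (8 : ℂ) * a ^ 2 = 0 := by
      simp only [Nat.cast_zero, mul_zero, zero_add, zero_mul, pow_zero, mul_one, sub_zero] at hB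
      linear_combination hB
    have ha : a = 0 := (pow_eq_zero_iff two_ne_zero).1 ((mul_eq_zero.1 h8).resolve_left (by norm_num))
    rw [ha, norm_zero]
    positivity
  · by_contra hlt
    push Not at hlt
    have hb0 : 0 ≤ ‖b‖ := norm_nonneg b
    have ha0 : 0 < ‖a‖ := lt_of_le_of_lt (by positivity) hlt
    have heq : (2 * (n : ℂ) + 4) * a ^ (2 * n + 2) = 2 * n * a ^ (2 * n) * b ^ 2 - 4 * a ^ 2 * b ^ (2 * n) := by
      linear_combination hB
    have hmain : (2 * (n : ℝ) + 4) * ‖a‖ ^ (2 * n + 2) ≤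
        2 * n * ‖a‖ ^ (2 * n) * ‖b‖ ^ 2 + 4 * ‖a‖ ^ 2 * ‖b‖ ^ (2 * n) := by
      have hc : ‖(2 * (n : ℂ) + 4)‖ = 2 * (n : ℝ) + 4 := by
        rw [show (2 * (n : ℂ) + 4) = ((2 * (n : ℝ) + 4 : ℝ) : ℂ) by push_cast; ring]
        rw [Complex.norm_real, Real.norm_of_nonneg (by positivity)]
      have hc2 : ‖(2 * (n : ℂ))‖ = 2 * (n : ℝ) := by
        rw [show (2 * (n : ℂ)) = ((2 * (n : ℝ) : ℝ) : ℂ) by push_cast; ring]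
        rw [Complex.norm_real, Real.norm_of_nonneg (by positivity)]
      calc (2 * (n : ℝ) + 4) * ‖a‖ ^ (2 * n + 2) = ‖(2 * (n : ℂ) + 4) * a ^ (2 * n + 2)‖ := by
            rw [norm_mul, norm_pow, hc]
        _ = ‖2 * n * a ^ (2 * n) * b ^ 2 - 4 * a ^ 2 * b ^ (2 * n)‖ := by rw [heq]
        _ ≤ ‖2 * n * a ^ (2 * n) * b ^ 2‖ + ‖4 * a ^ 2 * b ^ (2 * n)‖ := norm_sub_le _ _
        _ = 2 * n * ‖a‖ ^ (2 * n) * ‖b‖ ^ 2 + 4 * ‖a‖ ^ 2 * ‖b‖ ^ (2 * n) := by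
            rw [norm_mul, norm_mul, norm_pow, norm_pow, hc2, norm_mul, norm_mul, norm_pow, norm_pow]
            norm_num
    have hB2 : ‖b‖ ^ 2 ≤ ‖a‖ ^ 2 / 4 := by nlinarith
    have hB2n : ‖b‖ ^ (2 * n) ≤ ‖a‖ ^ (2 * n) / 4 := by
      have h1 : ‖b‖ ^ (2 * n) ≤ (‖a‖ / 2) ^ (2 * n) := pow_le_pow_left₀ hb0 (by linarith) _
      have h3 : (4 : ℝ) ≤ 2 ^ (2 * n) := by
        rw [pow_mul]
        norm_num
        exact le_self_pow₀ (by norm_num) (by omega)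
      rw [div_pow] at h1
      exact h1.trans (div_le_div_of_nonneg_left (by positivity) (by norm_num) h3)
    have hle : (2 * (n : ℝ) + 4) * ‖a‖ ^ (2 * n + 2) ≤ ((n : ℝ) / 2 + 1) * ‖a‖ ^ (2 * n + 2) :=
      calc (2 * (n : ℝ) + 4) * ‖a‖ ^ (2 * n + 2)
          ≤ 2 * n * ‖a‖ ^ (2 * n) * ‖b‖ ^ 2 + 4 * ‖a‖ ^ 2 * ‖b‖ ^ (2 * n) := hmain
        _ ≤ 2 * n * ‖a‖ ^ (2 * n) * (‖a‖ ^ 2 / 4) + 4 * ‖a‖ ^ 2 * (‖a‖ ^ (2 * n) / 4) := by gcongr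
        _ = ((n : ℝ) / 2 + 1) * ‖a‖ ^ (2 * n + 2) := by ring
    have hApos : 0 < ‖a‖ ^ (2 * n + 2) := pow_pos ha0 _
    nlinarith

/-- **The base part is bounded by `b`** once `|a| ≤ 2|b|`:
`|(a² - b²)² (a^{2n} + b^{2n})| ≤ 25 (4ⁿ + 1) |b|^{2n+4}`. -/
theorem norm_base_le (n : ℕ) {a b : ℂ} (ha : ‖a‖ ≤ 2 * ‖b‖) :
    ‖(a ^ 2 - b ^ 2) ^ 2 * (a ^ (2 * n) + b ^ (2 * n))‖ ≤ 25 * (4 ^ n + 1) * ‖b‖ ^ (2 * n + 4) := by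
  have hb0 : 0 ≤ ‖b‖ := norm_nonneg b
  have h1 : ‖a ^ 2 - b ^ 2‖ ≤ 5 * ‖b‖ ^ 2 := by
    refine (norm_sub_le _ _).trans ?_
    rw [norm_pow, norm_pow]
    nlinarith [norm_nonneg a]
  have h2 : ‖a ^ (2 * n) + b ^ (2 * n)‖ ≤ (4 ^ n + 1) * ‖b‖ ^ (2 * n) := by
    refine (norm_add_le _ _).trans ?_
    rw [norm_pow, norm_pow]
    have h : ‖a‖ ^ (2 * n) ≤ (2 * ‖b‖) ^ (2 * n) := pow_le_pow_left₀ (norm_nonneg _) ha _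
    have h4 : (2 * ‖b‖) ^ (2 * n) = 4 ^ n * ‖b‖ ^ (2 * n) := by
      rw [mul_pow, pow_mul]
      norm_num
    rw [h4] at h
    linarith
  calc ‖(a ^ 2 - b ^ 2) ^ 2 * (a ^ (2 * n) + b ^ (2 * n))‖
      = ‖a ^ 2 - b ^ 2‖ ^ 2 * ‖a ^ (2 * n) + b ^ (2 * n)‖ := by rw [norm_mul, norm_pow]
    _ ≤ (5 * ‖b‖ ^ 2) ^ 2 * ((4 ^ n + 1) * ‖b‖ ^ (2 * n)) :=
        mul_le_mul (pow_le_pow_left₀ (norm_nonneg _) h1 2) h2 (norm_nonneg _) (by positivity)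
    _ = 25 * (4 ^ n + 1) * ‖b‖ ^ (2 * n + 4) := by ring

/-! ## Uniqueness of the singular points -/
/-- **Every singular point of the pair-witness is `[p₊]` or `[p₋]`**, for the transversal coefficients
`c₁ (2n+4) ρ₁^{n+1} = 2`, `c₄ (2n+4)² ρ₂^{2n+2} = 1` with `ρ₁ = 2ρ₂`, `ρ₂ > 50(4ⁿ+1)`. -/
theorem eq_smul_of_grad_pairForm (n : ℕ) {ρ₁ ρ₂ : ℕ} {c₁ c₄ : ℂ}
    (hc₁ : c₁ * (2 * n + 4) * (ρ₁ : ℂ) ^ (n + 1) = 2) (hc₄ : c₄ * (2 * n + 4) ^ 2 * (ρ₂ : ℂ) ^ (2 * n + 2) = 1)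
    (hρ : ρ₁ = 2 * ρ₂) (hK : 50 * (4 ^ n + 1) < ρ₂) (z : Fin 5 → ℂ) (hz : z ≠ 0)
    (hgrad : ∀ j, eval z (pderiv j ((X 0 ^ 2 - X 2 ^ 2) ^ 2 * (X 0 ^ (2 * n) + X 2 ^ (2 * n)) +
        X 2 ^ (2 * n + 2) * (X 1 ^ 2 + X 3 * X 4) + C c₁ * X 1 ^ (2 * n + 4) + X 3 ^ (2 * n + 4) +
        C c₄ * X 4 ^ (2 * n + 4) : MvPolynomial (Fin 5) ℂ)) = 0) :
    ∃ i : Fin 2, ∃ t : ℂ, z = t • (![![1, 0, 1, 0, 0], ![-1, 0, 1, 0, 0]] : Fin 2 → Fin 5 → ℂ) i := by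
  have hd : (2 * (n : ℂ) + 4) ≠ 0 := by exact_mod_cast (show 2 * n + 4 ≠ 0 by omega)
  have hd2 : (2 * (n : ℂ) + 2) ≠ 0 := by exact_mod_cast (show 2 * n + 2 ≠ 0 by omega)
  have hc₁0 : c₁ ≠ 0 := by rintro rfl; norm_num at hc₁
  have hc₄0 : c₄ ≠ 0 := by rintro rfl; norm_num at hc₄
  -- the evaluated gradient
  have hg : ∀ j, eval z ((![C 4 * X 0 * (X 0 ^ 2 - X 2 ^ 2) * (X 0 ^ (2 * n) + X 2 ^ (2 * n)) +
            C (2 * (n : ℂ)) * (X 0 ^ 2 - X 2 ^ 2) ^ 2 * X 0 ^ (2 * n - 1),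
          C 2 * X 2 ^ (2 * n + 2) * X 1 + C (c₁ * (2 * (n : ℂ) + 4)) * X 1 ^ (2 * n + 3),
          -(C 4 * X 2 * (X 0 ^ 2 - X 2 ^ 2) * (X 0 ^ (2 * n) + X 2 ^ (2 * n))) +
            C (2 * (n : ℂ)) * (X 0 ^ 2 - X 2 ^ 2) ^ 2 * X 2 ^ (2 * n - 1) +
            C (2 * (n : ℂ) + 2) * X 2 ^ (2 * n + 1) * (X 1 ^ 2 + X 3 * X 4),
          X 2 ^ (2 * n + 2) * X 4 + C (2 * (n : ℂ) + 4) * X 3 ^ (2 * n + 3),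
          X 2 ^ (2 * n + 2) * X 3 + C (c₄ * (2 * (n : ℂ) + 4)) * X 4 ^ (2 * n + 3)] :
          Fin 5 → MvPolynomial (Fin 5) ℂ) j) = 0 :=
    fun j => by rw [← pderiv_pairForm_eq n c₁ c₄ j]; exact hgrad j
  have g0 := hg 0
  have g1 := hg 1
  have g2 := hg 2
  have g3 := hg 3
  have g4 := hg 4
  simp only [Matrix.cons_val_zero, Matrix.cons_val_one, Matrix.cons_val_two, Matrix.cons_val_three,
    Matrix.cons_val_four, Matrix.head_cons, Matrix.tail_cons, map_add, map_sub, map_neg, map_mul, map_pow,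
    eval_X, eval_C] at g0 g1 g2 g3 g4
  -- `2n x^{2n-1} x = 2n x^{2n}` (trivial for `n = 0`)
  have hpa : ∀ x : ℂ, 2 * (n : ℂ) * x ^ (2 * n - 1) * x = 2 * (n : ℂ) * x ^ (2 * n) := by
    intro x
    rcases Nat.eq_zero_or_pos n with rfl | hn
    · simp
    · rw [mul_assoc, ← pow_succ, Nat.sub_add_cancel (by omega)]
  -- base identities: `a ∂₀f = φ B(a,b)` and Euler `a ∂₀f + b ∂₂f = (2n+4) φ² g + (2n+2) b^{2n+2} Q`
  have e0 : (z 0 ^ 2 - z 2 ^ 2) * ((2 * (n : ℂ) + 4) * z 0 ^ (2 * n + 2) - 2 * n * z 0 ^ (2 * n) * z 2 ^ 2 +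
      4 * z 0 ^ 2 * z 2 ^ (2 * n)) = 0 := by
    linear_combination z 0 * g0 - (z 0 ^ 2 - z 2 ^ 2) ^ 2 * hpa (z 0)
  have e1 : (2 * (n : ℂ) + 4) * ((z 0 ^ 2 - z 2 ^ 2) ^ 2 * (z 0 ^ (2 * n) + z 2 ^ (2 * n))) +
      (2 * (n : ℂ) + 2) * z 2 ^ (2 * n + 2) * (z 1 ^ 2 + z 3 * z 4) = 0 := by
    linear_combination z 0 * g0 + z 2 * g2 - (z 0 ^ 2 - z 2 ^ 2) ^ 2 * hpa (z 0) -
      (z 0 ^ 2 - z 2 ^ 2) ^ 2 * hpa (z 2)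
  by_cases hb : z 2 = 0
  · -- `b = 0` forces `z = 0`
    exfalso
    apply hz
    rw [hb, zero_pow (by omega : 2 * n + 2 ≠ 0), mul_zero, zero_mul, zero_add] at g1
    rw [hb, zero_pow (by omega : 2 * n + 2 ≠ 0), zero_mul, zero_add] at g3 g4
    have e1z : z 1 = 0 :=
      (pow_eq_zero_iff (by omega : 2 * n + 3 ≠ 0)).1 ((mul_eq_zero.1 g1).resolve_left (mul_ne_zero hc₁0 hd))
    have e3z : z 3 = 0 := (pow_eq_zero_iff (by omega : 2 * n + 3 ≠ 0)).1 ((mul_eq_zero.1 g3).resolve_left hd)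
    have e4z : z 4 = 0 :=
      (pow_eq_zero_iff (by omega : 2 * n + 3 ≠ 0)).1 ((mul_eq_zero.1 g4).resolve_left (mul_ne_zero hc₄0 hd))
    have e0z : z 0 = 0 := by
      rw [hb, e1z, e3z, e4z] at e1
      have e1' : (2 * (n : ℂ) + 4) * ((z 0 ^ 2) ^ 2 * (z 0 ^ (2 * n) + 0 ^ (2 * n))) = 0 := by
        linear_combination e1
      rcases mul_eq_zero.1 e1' with h | h
      · exact absurd h hd
      · rcases mul_eq_zero.1 h with h | h
        · exact (pow_eq_zero_iff two_ne_zero).1 ((pow_eq_zero_iff two_ne_zero).1 h)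
        · rcases Nat.eq_zero_or_pos n with rfl | hn
          · norm_num at h
          · rw [zero_pow (by omega : 2 * n ≠ 0), add_zero] at h
            exact (pow_eq_zero_iff (by omega : 2 * n ≠ 0)).1 h
    funext i
    fin_cases i <;> simp [e0z, e1z, hb, e3z, e4z]
  · -- `b ≠ 0`
    have hbpos : 0 < ‖z 2‖ := norm_pos_iff.2 hb
    have hb2 : 0 < ‖z 2‖ ^ 2 := by positivity
    have hρ₁ : (ρ₁ : ℝ) = 2 * ρ₂ := by exact_mod_cast hρ
    have hKρ : (50 * (4 ^ n + 1) : ℝ) < ρ₂ := by exact_mod_cast hK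
    have hK0 : (0 : ℝ) < 50 * (4 ^ n + 1) := by positivity
    have hρ₂pos : (0 : ℝ) < ρ₂ := hK0.trans hKρ
    -- transversal dichotomy for `z₁`
    have T1 : z 1 = 0 ∨ ‖z 1 ^ 2‖ = ρ₁ * ‖z 2‖ ^ 2 := by
      by_cases h1 : z 1 = 0
      · exact Or.inl h1
      · right
        have h1' : c₁ * (2 * n + 4) * z 1 ^ (2 * n + 2) = -(2 * z 2 ^ (2 * n + 2)) := by
          apply mul_left_cancel₀ h1
          linear_combination g1
        have hpow : (z 1 ^ 2) ^ (n + 1) = -(((ρ₁ : ℂ) * z 2 ^ 2) ^ (n + 1)) := by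
          have h2 : (2 : ℂ) * (z 1 ^ 2) ^ (n + 1) = 2 * -(((ρ₁ : ℂ) * z 2 ^ 2) ^ (n + 1)) := by
            rw [show (z 1 ^ 2) ^ (n + 1) = z 1 ^ (2 * n + 2) by ring,
              show ((ρ₁ : ℂ) * z 2 ^ 2) ^ (n + 1) = (ρ₁ : ℂ) ^ (n + 1) * z 2 ^ (2 * n + 2) by ring]
            linear_combination (ρ₁ : ℂ) ^ (n + 1) * h1' - z 1 ^ (2 * n + 2) * hc₁
          exact mul_left_cancel₀ two_ne_zero h2
        rw [norm_eq_norm_of_pow_eq (Nat.succ_ne_zero n) (Or.inr hpow), norm_mul, norm_pow,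
          Complex.norm_natCast]
    -- transversal dichotomy for `(z₃, z₄)`
    have T2 : (z 3 = 0 ∧ z 4 = 0) ∨ ‖z 3 * z 4‖ = ρ₂ * ‖z 2‖ ^ 2 := by
      by_cases hv : z 3 * z 4 = 0
      · left
        rcases mul_eq_zero.1 hv with h3 | h4
        · refine ⟨h3, ?_⟩
          rw [h3, zero_pow (by omega : 2 * n + 3 ≠ 0), mul_zero, add_zero] at g3
          exact (mul_eq_zero.1 g3).resolve_left (pow_ne_zero _ hb)
        · refine ⟨?_, h4⟩
          rw [h4, zero_pow (by omega : 2 * n + 3 ≠ 0), mul_zero, add_zero] at g4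
          exact (mul_eq_zero.1 g4).resolve_left (pow_ne_zero _ hb)
      · right
        have g3' : (2 * (n : ℂ) + 4) * z 3 ^ (2 * n + 3) = -(z 2 ^ (2 * n + 2) * z 4) := by
          linear_combination g3
        have g4' : c₄ * (2 * (n : ℂ) + 4) * z 4 ^ (2 * n + 3) = -(z 2 ^ (2 * n + 2) * z 3) := by
          linear_combination g4
        have hP : c₄ * (2 * (n : ℂ) + 4) ^ 2 * (z 3 * z 4) ^ (2 * n + 2) * (z 3 * z 4) =
            z 2 ^ (4 * n + 4) * (z 3 * z 4) := by
          calc c₄ * (2 * (n : ℂ) + 4) ^ 2 * (z 3 * z 4) ^ (2 * n + 2) * (z 3 * z 4)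
              = ((2 * (n : ℂ) + 4) * z 3 ^ (2 * n + 3)) * (c₄ * (2 * (n : ℂ) + 4) * z 4 ^ (2 * n + 3)) := by
                ring
            _ = (-(z 2 ^ (2 * n + 2) * z 4)) * (-(z 2 ^ (2 * n + 2) * z 3)) := by rw [g3', g4']
            _ = z 2 ^ (4 * n + 4) * (z 3 * z 4) := by ring
        have hP' := mul_right_cancel₀ hv hP
        have hpow : (z 3 * z 4) ^ (2 * n + 2) = ((ρ₂ : ℂ) * z 2 ^ 2) ^ (2 * n + 2) := by
          rw [show ((ρ₂ : ℂ) * z 2 ^ 2) ^ (2 * n + 2) = (ρ₂ : ℂ) ^ (2 * n + 2) * z 2 ^ (4 * n + 4) by ring]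
          linear_combination (ρ₂ : ℂ) ^ (2 * n + 2) * hP' - (z 3 * z 4) ^ (2 * n + 2) * hc₄
        rw [norm_eq_norm_of_pow_eq (by omega : 2 * n + 2 ≠ 0) (Or.inl hpow), norm_mul, norm_pow,
          Complex.norm_natCast]
    by_cases hQ : z 1 ^ 2 + z 3 * z 4 = 0
    · -- `Q = 0`: the point lies over `φ = 0` and has no transversal component
      have hφg : (z 0 ^ 2 - z 2 ^ 2) ^ 2 * (z 0 ^ (2 * n) + z 2 ^ (2 * n)) = 0 := by
        rw [hQ, mul_zero, add_zero] at e1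
        exact (mul_eq_zero.1 e1).resolve_left hd
      have hφ : z 0 ^ 2 - z 2 ^ 2 = 0 := by
        rcases mul_eq_zero.1 hφg with h | h
        · exact (pow_eq_zero_iff two_ne_zero).1 h
        · -- `g = 0`: then `2n φ² b^{2n} = 0` from `b ∂₂f`, so `n = 0`, contradicting `g = 2`
          have h2n : 2 * (n : ℂ) * (z 0 ^ 2 - z 2 ^ 2) ^ 2 * z 2 ^ (2 * n) = 0 := by
            linear_combination z 2 * g2 - (z 0 ^ 2 - z 2 ^ 2) ^ 2 * hpa (z 2) +
              4 * z 2 ^ 2 * (z 0 ^ 2 - z 2 ^ 2) * h - (2 * (n : ℂ) + 2) * z 2 ^ (2 * n + 2) * hQ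
          rcases mul_eq_zero.1 h2n with h' | h'
          · rcases mul_eq_zero.1 h' with h'' | h''
            · have hn0 : n = 0 := by exact_mod_cast (mul_eq_zero.1 h'').resolve_left two_ne_zero
              subst hn0
              norm_num at h
            · exact (pow_eq_zero_iff two_ne_zero).1 h''
          · exact absurd ((pow_eq_zero_iff (by
              rintro h0; rw [h0, pow_zero, pow_zero] at h; norm_num at h)).1 h') hb
      have hz1 : z 1 = 0 := by
        rcases T1 with h1 | h1
        · exact h1
        · exfalso
          have hz1ne : z 1 ^ 2 ≠ 0 := by
            intro h0; rw [h0, norm_zero] at h1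
            have : (0 : ℝ) < ρ₁ * ‖z 2‖ ^ 2 := by rw [hρ₁]; exact mul_pos (mul_pos two_pos hρ₂pos) hb2
            linarith
          have hv : z 3 * z 4 = -(z 1 ^ 2) := by linear_combination hQ
          rcases T2 with ⟨h3, h4⟩ | h34
          · exact hz1ne (by rw [← neg_neg (z 1 ^ 2), ← hv, h3, zero_mul, neg_zero])
          · rw [hv, norm_neg, h1] at h34
            have hρeq : (ρ₁ : ℝ) = ρ₂ := mul_right_cancel₀ hb2.ne' h34
            rw [hρ₁] at hρeq
            linarith
      have hz34 : z 3 = 0 ∧ z 4 = 0 := by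
        rcases T2 with h | h34
        · exact h
        · exfalso
          rw [hz1, zero_pow two_ne_zero, zero_add] at hQ
          rw [hQ, norm_zero] at h34
          have : (0 : ℝ) < ρ₂ * ‖z 2‖ ^ 2 := mul_pos hρ₂pos hb2
          linarith
      rcases sq_eq_sq_iff_eq_or_eq_neg.1 (sub_eq_zero.1 hφ) with h | h
      · exact ⟨0, z 2, eq_smul_of_apply_eq (by simp [h]) (by simp [hz1]) (by simp) (by simp [hz34.1])
          (by simp [hz34.2])⟩
      · exact ⟨1, z 2, eq_smul_of_apply_eq (by simp [h]) (by simp [hz1]) (by simp) (by simp [hz34.1])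
          (by simp [hz34.2])⟩
    · -- `Q ≠ 0` is impossible: `|Q| ≤ 50(4ⁿ+1)|b|²` from the base, `|Q| ≥ ρ₂|b|²` from the transversal part
      exfalso
      have hφ : z 0 ^ 2 - z 2 ^ 2 ≠ 0 := by
        intro h0
        apply hQ
        rw [h0, zero_pow two_ne_zero, zero_mul, mul_zero, zero_add] at e1
        exact (mul_eq_zero.1 e1).resolve_left (mul_ne_zero hd2 (pow_ne_zero _ hb))
      have hB := (mul_eq_zero.1 e0).resolve_left hφ
      have ha : ‖z 0‖ ≤ 2 * ‖z 2‖ := norm_le_two_mul_norm n hB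
      have hh := norm_base_le n ha
      -- upper bound
      have hQle : ‖z 1 ^ 2 + z 3 * z 4‖ ≤ 50 * (4 ^ n + 1) * ‖z 2‖ ^ 2 := by
        have heq : (2 * (n : ℂ) + 2) * z 2 ^ (2 * n + 2) * (z 1 ^ 2 + z 3 * z 4) =
            -((2 * (n : ℂ) + 4) * ((z 0 ^ 2 - z 2 ^ 2) ^ 2 * (z 0 ^ (2 * n) + z 2 ^ (2 * n)))) := by
          linear_combination e1
        have hc : ‖(2 * (n : ℂ) + 4)‖ = 2 * (n : ℝ) + 4 := by
          rw [show (2 * (n : ℂ) + 4) = ((2 * (n : ℝ) + 4 : ℝ) : ℂ) by push_cast; ring]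
          rw [Complex.norm_real, Real.norm_of_nonneg (by positivity)]
        have hc2 : ‖(2 * (n : ℂ) + 2)‖ = 2 * (n : ℝ) + 2 := by
          rw [show (2 * (n : ℂ) + 2) = ((2 * (n : ℝ) + 2 : ℝ) : ℂ) by push_cast; ring]
          rw [Complex.norm_real, Real.norm_of_nonneg (by positivity)]
        have key : (2 * (n : ℝ) + 2) * ‖z 2‖ ^ (2 * n + 2) * ‖z 1 ^ 2 + z 3 * z 4‖ ≤
            (2 * (n : ℝ) + 4) * (25 * (4 ^ n + 1) * ‖z 2‖ ^ (2 * n + 4)) := by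
          have h := congrArg norm heq
          rw [norm_mul, norm_mul, norm_pow, hc2, norm_neg, norm_mul, hc] at h
          rw [h]
          gcongr
        have key2 : (2 * (n : ℝ) + 2) * ‖z 2‖ ^ (2 * n + 2) * ‖z 1 ^ 2 + z 3 * z 4‖ ≤
            (2 * (n : ℝ) + 2) * ‖z 2‖ ^ (2 * n + 2) * (50 * (4 ^ n + 1) * ‖z 2‖ ^ 2) := by
          refine key.trans ?_
          have hpw : ‖z 2‖ ^ (2 * n + 4) = ‖z 2‖ ^ (2 * n + 2) * ‖z 2‖ ^ 2 := by ring
          have hnn : (0 : ℝ) ≤ 2 * n * (25 * (4 ^ n + 1) * (‖z 2‖ ^ (2 * n + 2) * ‖z 2‖ ^ 2)) := by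
            positivity
          rw [hpw]
          linarith
        have hpos : (0 : ℝ) < (2 * (n : ℝ) + 2) * ‖z 2‖ ^ (2 * n + 2) := by positivity
        exact le_of_mul_le_mul_left key2 hpos
      -- lower bound
      have hQge : (ρ₂ : ℝ) * ‖z 2‖ ^ 2 ≤ ‖z 1 ^ 2 + z 3 * z 4‖ := by
        rcases T1 with h1 | h1 <;> rcases T2 with ⟨h3, h4⟩ | h34
        · exact absurd (by rw [h1, h3]; ring) hQ
        · rw [h1, zero_pow two_ne_zero, zero_add, h34]
        · rw [h3, zero_mul, add_zero, h1, hρ₁]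
          nlinarith
        · have hsub : ‖z 1 ^ 2‖ ≤ ‖z 1 ^ 2 + z 3 * z 4‖ + ‖z 3 * z 4‖ := by
            have h := norm_sub_le (z 1 ^ 2 + z 3 * z 4) (z 3 * z 4)
            rwa [add_sub_cancel_right] at h
          rw [h1, h34, hρ₁] at hsub
          nlinarith
      nlinarith

/-! ## The third conjunct of the stub -/

/-- **The exchanged-pair witness**: for every `n`, with `ρ₂ = 50(4ⁿ+1) + 1`, `ρ₁ = 2ρ₂`,
`c₁ = 2/((2n+4)ρ₁^{n+1})`, `c₄ = 1/((2n+4)²ρ₂^{2n+2})`, the quinary form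
`(x₀²-x₂²)²(x₀^{2n}+x₂^{2n}) + x₂^{2n+2}(x₁²+x₃x₄) + c₁x₁^{2n+4} + x₃^{2n+4} + c₄x₄^{2n+4}` of degree
`2n + 4` is ι-even and nodal with exactly the two nodes `p± = [±1:0:1:0:0]` (third conjunct of
`stub_signNodalForms` at `d = 2n + 4`). -/
theorem exists_pairNodalForm (n : ℕ) :
    ∃ f : MvPolynomial (Fin 5) ℂ, f.IsHomogeneous (2 * n + 4) ∧
      (∀ e : Fin 5 →₀ ℕ, ¬ Even (e 0 + e 1) → f.coeff e = 0) ∧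
      IsNodalFormWithNodes f ![(![1, 0, 1, 0, 0] : Fin 5 → ℂ), ![-1, 0, 1, 0, 0]] := by
  set ρ₂ : ℕ := 50 * (4 ^ n + 1) + 1 with hρ₂
  set ρ₁ : ℕ := 2 * ρ₂ with hρ₁
  have hρ₂0 : (ρ₂ : ℂ) ≠ 0 := Nat.cast_ne_zero.2 (by omega)
  have hρ₁0 : (ρ₁ : ℂ) ≠ 0 := Nat.cast_ne_zero.2 (by omega)
  have hd : (2 * (n : ℂ) + 4) ≠ 0 := by exact_mod_cast (show 2 * n + 4 ≠ 0 by omega)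
  set c₁ : ℂ := 2 / ((2 * n + 4) * (ρ₁ : ℂ) ^ (n + 1)) with hc₁
  set c₄ : ℂ := 1 / ((2 * n + 4) ^ 2 * (ρ₂ : ℂ) ^ (2 * n + 2)) with hc₄
  have hc₁' : c₁ * (2 * n + 4) * (ρ₁ : ℂ) ^ (n + 1) = 2 := by
    rw [hc₁]
    field_simp
  have hc₄' : c₄ * (2 * n + 4) ^ 2 * (ρ₂ : ℂ) ^ (2 * n + 2) = 1 := by
    rw [hc₄]
    field_simp
  refine ⟨((X 0 ^ 2 - X 2 ^ 2) ^ 2 * (X 0 ^ (2 * n) + X 2 ^ (2 * n)) +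
      X 2 ^ (2 * n + 2) * (X 1 ^ 2 + X 3 * X 4) + C c₁ * X 1 ^ (2 * n + 4) + X 3 ^ (2 * n + 4) +
      C c₄ * X 4 ^ (2 * n + 4) : MvPolynomial (Fin 5) ℂ), ?_, ?_, ?_⟩
  · -- homogeneous of degree `2n + 4`
    have hX : ∀ i : Fin 5, (X i : MvPolynomial (Fin 5) ℂ).IsHomogeneous 1 := fun i => isHomogeneous_X ℂ i
    have hA : ((X 0 ^ 2 - X 2 ^ 2) ^ 2 * (X 0 ^ (2 * n) + X 2 ^ (2 * n)) :
        MvPolynomial (Fin 5) ℂ).IsHomogeneous (2 * n + 4) := by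
      have h := ((((hX 0).pow 2).sub ((hX 2).pow 2)).pow 2).mul (((hX 0).pow (2 * n)).add ((hX 2).pow (2 * n)))
      rwa [show 1 * 2 * 2 + 1 * (2 * n) = 2 * n + 4 by ring] at h
    have hB : (X 2 ^ (2 * n + 2) * (X 1 ^ 2 + X 3 * X 4) : MvPolynomial (Fin 5) ℂ).IsHomogeneous (2 * n + 4) := by
      have h := ((hX 2).pow (2 * n + 2)).mul (((hX 1).pow 2).add ((hX 3).mul (hX 4)))
      rwa [show 1 * (2 * n + 2) + 1 * 2 = 2 * n + 4 by ring] at h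
    have hP : ∀ i : Fin 5, (X i ^ (2 * n + 4) : MvPolynomial (Fin 5) ℂ).IsHomogeneous (2 * n + 4) :=
      fun i => by simpa using (hX i).pow (2 * n + 4)
    have hC : ∀ (c : ℂ) (i : Fin 5), (C c * X i ^ (2 * n + 4) : MvPolynomial (Fin 5) ℂ).IsHomogeneous
        (2 * n + 4) := fun c i => by simpa using (isHomogeneous_C (Fin 5) c).mul (hP i)
    exact (((hA.add hB).add (hC c₁ 1)).add (hP 3)).add (hC c₄ 4)
  · -- ι-even: fixed by `(x₀, x₁) ↦ (-x₀, -x₁)`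
    intro e he
    refine coeff_eq_zero_of_sign_aeval_eq _ ?_ e he
    have h2n : Even (2 * n) := even_two_mul n
    have h2n4 : Even (2 * n + 4) := h2n.add ⟨2, rfl⟩
    simp +decide only [map_add, map_sub, map_mul, map_pow, sign_aeval_X, aeval_C, algebraMap_eq, if_true,
      if_false, map_one, one_mul, map_neg, neg_one_mul, neg_sq, h2n.neg_pow, h2n4.neg_pow]
  · -- nodal with exactly the nodes `p±`
    exact ⟨(isOrdinaryDoublePointOf_pairForm n c₁ c₄).1, (isOrdinaryDoublePointOf_pairForm n c₁ c₄).2,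
      fun z hz hgrad => eq_smul_of_grad_pairForm n hc₁' hc₄' hρ₁ (by omega) z hz hgrad⟩

end Summit.HodgeConjecture.HodgeConjecture.Theorems.SignSymmetricPowersNodalFormPair

end
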